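/-
Copyright (c) 2026 the pub-hodgecm-mathlib formalisation cell (harness21).  Prover seat hodgecm-mathlib-K2E1-p15 (g4), Track B ∕ K2-LIT, h413 = `stmt-HodgeConjecture-24833`, route `HCCMUnconditional`,
R90-TF section S8 «ContSpec-n½», deal S8-R237 (2) (S8 dealer R90-CS-plan (g3)): THE PAYER OF K2E2-p12's NAMED GLOBAL LETTER `hreal` (axis reality of the closed-formula `wc` of record,
★ p864687 `K2E1ChiMaassSelbergOnAxisScalarsOfRecordCMThree` :232–234) — LETTER-FREE, from the continued diagonal Maass–Selberg identity and positivity alone (census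
`R90/S8/CENSUS-AxisReality.K2E1-p15-g4.md`, 2026-09-05 03:07Z).
-/
import Summits.HodgeConjecture.HodgeConjecture.Theorems.K2E1ChiMaassSelbergOnAxisScalarsOfRecordCMThree   -- ★ p864687 (K2E2-p12): (L2) of record, §2 regular data, head; brings ★ `hE6_midWitness`, ★ spec, ★ p864494 OFF-AXIS, ★ p862892 diagonal identities, ★ TUBE-FREE
import HarnessLib

/-!
# h413 ∕ R90-S8 — `K2E1ChiAxisRealityOfRecordCMThree`: AXIS REALITY OF THE MAASS–SELBERG CROSS SCALAR `wc` OFF THE POLES IS FORCED BY THE CONTINUED DIAGONAL IDENTITY AND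
# POSITIVITY — the named global letter `hreal` of ★ p864687 DISCHARGED, letter-free; `hMSP′` at the witness family of ONE letter (`hqa`)

Cell `pub/hodgecm-mathlib`, crux h413 = `stmt-HodgeConjecture-24833`, route `HCCMUnconditional`; R90-TF section S8, deal S8-R237 (2); (V) OF RECORD :358 letter `hreal`.  THEOREMS ONLY (no `def`,
no `instance`, no notation, no named-fact hypothesis, no `sorry`; default heartbeats); lane `--supports stmt-HodgeConjecture-24833 --as helper` (count-neutral).  Closes no socket.

THE MATHEMATICS ([MoeglinWaldspurger1995, IV.1.10–IV.1.11, IV.2.3, IV.3.12 (a)]; [Langlands1976, §7]; [BernsteinLapid2019, §4]).  The classical proof that the cross scalar `c(s) = ⟨M(s)φ_s, φ⟩` of the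
Maass–Selberg relation is real on the real axis is the ADJOINT RELATION `M(s)* = M(s̄)` ([MW95] II.1.8 ∕ IV.1.10) — at a general level `(K′, ω)` a genuine statement about the ramified and
archimedean local intertwiners, NOT in the tree (it needs the adelic big-cell integration formula).  It is NOT NEEDED off the poles: for a real `x > 1` off the closed co-discrete pole set `P`
and `z = x + iy`, `y > 0` small, the continued diagonal identity (★ p862892 `normSq_family_eq_chiFourTerm_of_tube`)
  `‖F z‖² = Cμ·CK·( a·T^{2x−2}∕(2x−2) + [T^{z−z̄}·conj(w z) − T^{−(z−z̄)}·w z]∕(z−z̄) − T^{−(2x−2)}∕(2x−2)·B z z )`,   `Cμ, CK > 0` (★ `chiTube_threeScalars_uniform_free`),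
multiplied by `z − z̄ = 2iy` has imaginary part `Im(T^{2iy}·conj(w z) − T^{−2iy}·w z) = 2y·(‖F z‖²∕(CμCK) − Re(a·T^{2x−2}∕(2x−2)) + Re(T^{−(2x−2)}∕(2x−2)·B z z)) ≥ −2K₀·y` as soon as `B z z` is
bounded near `x` (`K₀` a constant), while the left side tends to `Im(conj(w x) − w x) = −2·Im w(x)` as `y → 0⁺` (`w` continuous at `x`): hence `Im w(x) ≤ 0` (§1).  The lower quarter-plane
identity is the upper one for the reflected data `w♯ = conj∘w∘conj`, `B♯`, `F∘conj` (★ `normSq_family_eq_chiFourTerm_lower_of_tube`), whence `Im w♯(x) = −Im w(x) ≤ 0` too: **`Im w(x) = 0`**.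
No self-associate case split, no adjointness, no `hqa`: at `x ∉ P` the continued coordinates are analytic by the exports' clause 13 (so `Bc z z` is bounded near `x`, `wc` continuous at `x`).
* §0 `chiFourTerm_middle_eq` — the algebra `Q·conj w − Q′·w = E·(N∕(c₁c₂) − P∕S·a + R∕S·B)` of the four-term solved for its middle pair.
* §1 **`im_apply_le_zero_of_normSq_eq_chiFourTerm_upper`** (pure analysis, generic `w B N`: the UPPER identity eventually on `𝓝[≠] x ∩ {0 < Im}` ⇒ `Im w(x) ≤ 0`),
  **`im_apply_eq_zero_of_normSq_eq_chiFourTerm`** (upper identity + the lower theorem's reflected bytes ⇒ `Im w(x) = 0`).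
* §2 EXPORTS LEVEL **`im_wc_eq_zero_of_exports_free`** — binders of ★ p864494 `hMSP_of_exports_free_at` up to `hBagree`, then `(hx : 1 < x) (hxP : ↑x ∉ P) (hβB)`: `(wc x).im = 0`.
* §3 OF RECORD: HEAD **`hreal_midWitness`** = the `hreal` binder of ★ p864687 :232–234 BYTE FOR BYTE over the frame binders of `hMSP'_midWitness_of_coordLetters` — LETTER-FREE; and
  **`hMSP'_midWitness_of_coordLetter`** = ★ p864687's head with `hreal` DISCHARGED (one named global letter left: `hqa`, the scalar half).
HONEST LABEL: HC_CM is proved only modulo the 7 printed citations (2 remaining named inputs: hLiu418 = `stmt-HodgeConjecture-24832`, h413 = `stmt-HodgeConjecture-24833`) until rung 0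
closes; this file asserts no named fact and closes no socket; it removes ONE named letter (`hreal`) of the (V) OF RECORD — `hMSP′` is now ★ MODULO `hqa` alone; REL ≠ ★ ≠ BUILT; count-neutral.

## References
* [MoeglinWaldspurger1995] C. Mœglin, J.-L. Waldspurger, *Spectral Decomposition and Eisenstein Series* (1995), IV.1.10–IV.1.11, IV.2.3, IV.3.12 (a).
* [Langlands1976] R. P. Langlands, *On the Functional Equations Satisfied by Eisenstein Series*, LNM 544 (1976), §7.
* [BernsteinLapid2019] J. Bernstein, E. Lapid, *On the meromorphic continuation of Eisenstein series*, J. AMS 37 (2024), Thm 2.3, §4.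
-/

set_option autoImplicit false
set_option linter.dupNamespace false  -- the mandated namespace repeats the summit's segment (`HodgeConjecture.HodgeConjecture`)

noncomputable section

open MeasureTheory Measure NumberField IsDedekindDomain Set Filter Topology Complex
open scoped ENNReal NNReal ComplexConjugate InnerProductSpace
open Literature.MeasureTheory.Group Literature.NumberTheory Literature.NumberTheory.Automorphic Literature.NumberTheory.Automorphic.UnitaryGroup Literature.NumberTheory.GaloisRepresentations AdelicGroupData
open Literature.NumberTheory.Automorphic.Arthur2013.Leaves.TECR Literature.NumberTheory.Rogawski1990
open Summit.HodgeConjecture.HodgeConjecture.Cruxes.H413.K2E1BorelEisensteinU Summit.HodgeConjecture.HodgeConjecture.Cruxes.H413.K2E1CharacterEisensteinU2Defs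
open Summit.HodgeConjecture.HodgeConjecture.Cruxes.H413.K2E1CharacterEisensteinU3PairDefs Summit.HodgeConjecture.HodgeConjecture.Cruxes.H413.K2E1BLBorelSpacesU2Defs
open Summit.HodgeConjecture.HodgeConjecture.Cruxes.H413.K2E1ChiSectionSpaceU2Defs (chiSectionSpace isChiSection_of_mem)
open Summit.HodgeConjecture.HodgeConjecture.Cruxes.H413.K2E1ChiMaassSelbergDiagonalCMThree (normSq_family_eq_chiFourTerm_of_tube normSq_family_eq_chiFourTerm_lower_of_tube)
open Summit.HodgeConjecture.HodgeConjecture.Cruxes.H413.K2E1ChiMaassSelbergTubeFreeCMThree (chiTube_threeScalars_uniform_free)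
open Summit.HodgeConjecture.HodgeConjecture.Cruxes.H413.K2E1ChiEisensteinRealAxisPoleLedgerOfExportsCMThree (quarterDomains_of_codiscrete)
open Summit.HodgeConjecture.HodgeConjecture.Cruxes.H413.K2E1ChiMaassSelbergPoleExclusionOffAxisCMThree (eventually_mem_quarterDomains_of_codiscrete)
open Summit.HodgeConjecture.HodgeConjecture.Cruxes.H413.K2E1ChiMaassSelbergOnAxisScalarsOfRecordCMThree (exists_scalars_of_coords_global exists_eventually_norm_kernelDiag_le_of_coords
  hMSP'_midWitness_of_coordLetters)
open Summit.HodgeConjecture.HodgeConjecture.Cruxes.H413.K2E1ChiTruncatedFamilyTransportCMThree (hE6_midWitness)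
open Summit.HodgeConjecture.HodgeConjecture.Cruxes.H413.R90S8ResGMidBlockScatteringOfRecordU3 (integrable_restrict_mul_conj_of_bounded)
open Summit.HodgeConjecture.HodgeConjecture.Cruxes.H413.K2E1ChiEisensteinMeromorphicExportsM1CMThree (one_apply_torus isAutomorphic_one)
open Summit.HodgeConjecture.HodgeConjecture.R90.S8 (midWitnessEc midWitnessP midWitnessQc midWitnessQ midWitnessExports_spec)

namespace Summit.HodgeConjecture.HodgeConjecture.Cruxes.H413.K2E1ChiAxisRealityOfRecordCMThree

/-! ## §0 The algebra of the four-term solved for its middle pair -/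

/-- `N = c₁·(c₂·(P∕S·a + Q∕E·w̄ − Q′∕E·w − R∕S·B))` with `c₁ c₂ S E ≠ 0` ⇒ `Q·w̄ − Q′·w = E·(N∕(c₁c₂) − P∕S·a + R∕S·B)`. [folklore] -/
theorem chiFourTerm_middle_eq {N c₁ c₂ S E P Q Q' R a cw w B : ℂ} (hc₁ : c₁ ≠ 0) (hc₂ : c₂ ≠ 0) (hS : S ≠ 0) (hE : E ≠ 0)
    (h : N = c₁ * (c₂ * (P / S * a + Q / E * cw - Q' / E * w - R / S * B))) :
    Q * cw - Q' * w = E * (N / (c₁ * c₂) - P / S * a + R / S * B) := by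
  subst h
  field_simp
  ring

/-! ## §1 Pure analysis: the upper identity near a real point forces `Im w(x) ≤ 0`; with the reflected lower identity, `Im w(x) = 0` -/

/-- **THE UPPER HALF OF AXIS REALITY.**  Let `x > 1` be real, `Cμ·CK > 0`, `a` real, `T > 0`, `w : ℂ → ℂ` continuous at `x`, `B z z` bounded on the punctured upper neighbourhood of `x`, and
`N ≥ 0` a real function with, eventually on `𝓝[≠] x ∩ {0 < Im z}`,
`N z = Cμ·(CK·( T^{z+z̄−2}∕(z+z̄−2)·a + T^{z−z̄}∕(z−z̄)·conj(w z) − T^{−(z−z̄)}∕(z−z̄)·w z − T^{−(z+z̄−2)}∕(z+z̄−2)·B z z ))` (the continued diagonal Maass–Selberg identity, `N z = ‖F z‖²`).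
Then `Im w(x) ≤ 0`: along `z = x + it`, `t → 0⁺`, `Im(T^{2it}·conj w(z) − T^{−2it}·w(z)) = 2t·(N z∕(CμCK) − Re(T^{2x−2}∕(2x−2)·a) + Re(T^{−(2x−2)}∕(2x−2)·B z z)) ≥ −2K₀t`
while the left side tends to `−2·Im w(x)`. [cite: MoeglinWaldspurger1995, IV.2.3, IV.3.12 (a)] [cite: Langlands1976, §7] -/
theorem im_apply_le_zero_of_normSq_eq_chiFourTerm_upper {x : ℝ} (hx : 1 < x) {Cμ CK : ℝ} (hC : 0 < Cμ * CK) (a : ℝ) {T : ℝ} (hT : 0 < T)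
    {w : ℂ → ℂ} (hw : ContinuousAt w (x : ℂ)) {B : ℂ → ℂ → ℂ} {B₀ : ℝ} (hB : ∀ᶠ z in 𝓝[≠] (x : ℂ), 0 < z.im → ‖B z z‖ ≤ B₀)
    (N : ℂ → ℝ) (hN : ∀ z, 0 ≤ N z)
    (hMS : ∀ᶠ z in 𝓝[≠] (x : ℂ), 0 < z.im → ((N z : ℝ) : ℂ) = ((Cμ : ℝ) : ℂ) * (((CK : ℝ) : ℂ) *
        ((((T : ℝ) : ℂ) ^ (z + conj z - 2) / (z + conj z - 2)) * ((a : ℝ) : ℂ)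
          + (((T : ℝ) : ℂ) ^ (z - conj z) / (z - conj z)) * conj (w z)
          - (((T : ℝ) : ℂ) ^ (-(z - conj z)) / (z - conj z)) * w z
          - (((T : ℝ) : ℂ) ^ (-(z + conj z - 2)) / (z + conj z - 2)) * B z z))) :
    (w x).im ≤ 0 := by
  have hCμ0 : ((Cμ : ℝ) : ℂ) ≠ 0 := ofReal_ne_zero.2 (mul_ne_zero_iff.1 hC.ne').1
  have hCK0 : ((CK : ℝ) : ℂ) ≠ 0 := ofReal_ne_zero.2 (mul_ne_zero_iff.1 hC.ne').2
  have hS0 : ((2 * x - 2 : ℝ) : ℂ) ≠ 0 := ofReal_ne_zero.2 (by linarith)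
  have hT0 : ((T : ℝ) : ℂ) ≠ 0 := ofReal_ne_zero.2 hT.ne'
  have hpath : Tendsto (fun t : ℝ => (x : ℂ) + (t : ℂ) * I) (𝓝[>] (0 : ℝ)) (𝓝[≠] (x : ℂ)) := by
    refine tendsto_nhdsWithin_iff.2 ⟨?_, ?_⟩
    · have hc : Continuous fun t : ℝ => (x : ℂ) + (t : ℂ) * I := by fun_prop
      exact (hc.tendsto' 0 (x : ℂ) (by simp)).mono_left nhdsWithin_le_nhds
    · filter_upwards [self_mem_nhdsWithin] with t ht
      rw [mem_compl_singleton_iff]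
      intro h
      have h' := congrArg Complex.im h
      simp only [add_im, ofReal_im, mul_im, ofReal_re, I_im, mul_one, I_re, mul_zero, add_zero, zero_add] at h'
      exact (ne_of_gt (mem_Ioi.1 ht)) h'
  have hpath₀ : Tendsto (fun t : ℝ => (x : ℂ) + (t : ℂ) * I) (𝓝[>] (0 : ℝ)) (𝓝 (x : ℂ)) := hpath.mono_right nhdsWithin_le_nhds
  have him : ∀ t : ℝ, ((x : ℂ) + (t : ℂ) * I).im = t := fun t => by simp
  have hsum : ∀ t : ℝ, (x : ℂ) + (t : ℂ) * I + conj ((x : ℂ) + (t : ℂ) * I) - 2 = ((2 * x - 2 : ℝ) : ℂ) := fun t => by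
    apply Complex.ext <;> simp; ring
  have hdiff : ∀ t : ℝ, (x : ℂ) + (t : ℂ) * I - conj ((x : ℂ) + (t : ℂ) * I) = ((2 * t : ℝ) : ℂ) * I := fun t => by
    apply Complex.ext <;> simp; ring
  set K₀ : ℝ := (((T : ℝ) : ℂ) ^ (((2 * x - 2 : ℝ) : ℂ)) / ((2 * x - 2 : ℝ) : ℂ) * ((a : ℝ) : ℂ)).re + ‖((T : ℝ) : ℂ) ^ (-(((2 * x - 2 : ℝ) : ℂ))) / ((2 * x - 2 : ℝ) : ℂ)‖ * B₀ with hK₀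
  -- (i) the eventual inequality along the path
  have hineq : ∀ᶠ t : ℝ in 𝓝[>] (0 : ℝ), 0 ≤ (((T : ℝ) : ℂ) ^ (((2 * t : ℝ) : ℂ) * I) * conj (w ((x : ℂ) + (t : ℂ) * I)) -
      ((T : ℝ) : ℂ) ^ (-(((2 * t : ℝ) : ℂ) * I)) * w ((x : ℂ) + (t : ℂ) * I)).im + 2 * K₀ * t := by
    filter_upwards [hpath.eventually hMS, hpath.eventually hB, self_mem_nhdsWithin] with t hM hBt ht
    have ht0 : 0 < t := mem_Ioi.1 ht
    have hM' := hM (by rw [him]; exact ht0)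
    have hBt' := hBt (by rw [him]; exact ht0)
    rw [hsum t, hdiff t] at hM'
    have hE0 : ((2 * t : ℝ) : ℂ) * I ≠ 0 := mul_ne_zero (ofReal_ne_zero.2 (by positivity)) I_ne_zero
    rw [chiFourTerm_middle_eq hCμ0 hCK0 hS0 hE0 hM']
    -- `Im (2it · Y) = 2t · Re Y`
    have hIm : ∀ Y : ℂ, (((2 * t : ℝ) : ℂ) * I * Y).im = 2 * t * Y.re := fun Y => by
      simp only [mul_im, mul_re, ofReal_re, ofReal_im, I_re, I_im, mul_zero, mul_one, sub_zero, zero_mul, add_zero, zero_add]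
    rw [hIm, add_re, sub_re]
    have h1 : 0 ≤ (((N ((x : ℂ) + (t : ℂ) * I) : ℝ) : ℂ) / (((Cμ : ℝ) : ℂ) * ((CK : ℝ) : ℂ))).re := by
      rw [← ofReal_mul, ← ofReal_div, ofReal_re]
      exact div_nonneg (hN _) hC.le
    have h2 : -(‖((T : ℝ) : ℂ) ^ (-(((2 * x - 2 : ℝ) : ℂ))) / ((2 * x - 2 : ℝ) : ℂ)‖ * B₀) ≤
        (((T : ℝ) : ℂ) ^ (-(((2 * x - 2 : ℝ) : ℂ))) / ((2 * x - 2 : ℝ) : ℂ) * B ((x : ℂ) + (t : ℂ) * I) ((x : ℂ) + (t : ℂ) * I)).re := by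
      have h3 := (abs_le.1 (abs_re_le_norm (((T : ℝ) : ℂ) ^ (-(((2 * x - 2 : ℝ) : ℂ))) / ((2 * x - 2 : ℝ) : ℂ) * B ((x : ℂ) + (t : ℂ) * I) ((x : ℂ) + (t : ℂ) * I)))).1
      rw [norm_mul] at h3
      nlinarith [mul_le_mul_of_nonneg_left hBt' (norm_nonneg (((T : ℝ) : ℂ) ^ (-(((2 * x - 2 : ℝ) : ℂ))) / ((2 * x - 2 : ℝ) : ℂ)))]
    have h4 : 0 ≤ 2 * t * ((((N ((x : ℂ) + (t : ℂ) * I) : ℝ) : ℂ) / (((Cμ : ℝ) : ℂ) * ((CK : ℝ) : ℂ))).re -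
        (((T : ℝ) : ℂ) ^ (((2 * x - 2 : ℝ) : ℂ)) / ((2 * x - 2 : ℝ) : ℂ) * ((a : ℝ) : ℂ)).re +
        (((T : ℝ) : ℂ) ^ (-(((2 * x - 2 : ℝ) : ℂ))) / ((2 * x - 2 : ℝ) : ℂ) * B ((x : ℂ) + (t : ℂ) * I) ((x : ℂ) + (t : ℂ) * I)).re + K₀) :=
      mul_nonneg (by positivity) (by rw [hK₀]; linarith)
    linarith
  -- (ii) the limit of the same quantity as `t → 0⁺` is `−2·Im w(x)`
  have hcpow : Tendsto (fun s : ℂ => ((T : ℝ) : ℂ) ^ s) (𝓝 0) (𝓝 1) := by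
    have h0 : ContinuousAt (fun s : ℂ => ((T : ℝ) : ℂ) ^ s) 0 := continuousAt_const_cpow hT0
    simpa only [cpow_zero] using h0.tendsto
  have h2t : Tendsto (fun t : ℝ => ((2 * t : ℝ) : ℂ) * I) (𝓝[>] (0 : ℝ)) (𝓝 0) := by
    have hc : Continuous fun t : ℝ => ((2 * t : ℝ) : ℂ) * I := by fun_prop
    exact (hc.tendsto' 0 0 (by simp)).mono_left nhdsWithin_le_nhds
  have hP : Tendsto (fun t : ℝ => ((T : ℝ) : ℂ) ^ (((2 * t : ℝ) : ℂ) * I)) (𝓝[>] (0 : ℝ)) (𝓝 1) := hcpow.comp h2t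
  have hQ : Tendsto (fun t : ℝ => ((T : ℝ) : ℂ) ^ (-(((2 * t : ℝ) : ℂ) * I))) (𝓝[>] (0 : ℝ)) (𝓝 1) :=
    hcpow.comp (by simpa only [neg_zero] using h2t.neg)
  have hwz : Tendsto (fun t : ℝ => w ((x : ℂ) + (t : ℂ) * I)) (𝓝[>] (0 : ℝ)) (𝓝 (w x)) := hw.tendsto.comp hpath₀
  have hcw : Tendsto (fun t : ℝ => conj (w ((x : ℂ) + (t : ℂ) * I))) (𝓝[>] (0 : ℝ)) (𝓝 (conj (w x))) := (continuous_conj.tendsto _).comp hwz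
  have hKt : Tendsto (fun t : ℝ => 2 * K₀ * t) (𝓝[>] (0 : ℝ)) (𝓝 0) := by
    have hc : Continuous fun t : ℝ => 2 * K₀ * t := by fun_prop
    exact (hc.tendsto' 0 0 (by simp)).mono_left nhdsWithin_le_nhds
  have hlim : Tendsto (fun t : ℝ => (((T : ℝ) : ℂ) ^ (((2 * t : ℝ) : ℂ) * I) * conj (w ((x : ℂ) + (t : ℂ) * I)) -
      ((T : ℝ) : ℂ) ^ (-(((2 * t : ℝ) : ℂ) * I)) * w ((x : ℂ) + (t : ℂ) * I)).im + 2 * K₀ * t) (𝓝[>] (0 : ℝ)) (𝓝 ((1 * conj (w x) - 1 * w x).im + 0)) :=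
    ((continuous_im.tendsto _).comp ((hP.mul hcw).sub (hQ.mul hwz))).add hKt
  have hval : (1 * conj (w x) - 1 * w x).im + 0 = -2 * (w x).im := by
    simp only [one_mul, sub_im, conj_im, add_zero]
    ring
  rw [hval] at hlim
  have key := ge_of_tendsto hlim hineq
  linarith

/-- **AXIS REALITY OFF THE POLES FROM THE TWO CONTINUED DIAGONAL IDENTITIES** — §1's upper identity for `(w, B, N₁)` and, in the BYTES of ★ `normSq_family_eq_chiFourTerm_lower_of_tube`,
the lower identity `N₂ u = Cμ·(CK·R_χ(u, u; w♯, B♯))`, `w♯ = conj∘w∘conj`, `B♯ u u = conj(B ū ū)`, eventually on `𝓝[≠] x ∩ {0 < Im u}` (i.e. at the points `ū` BELOW the axis), with `B`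
bounded on both punctured half-neighbourhoods: then **`Im w(x) = 0`** (`Im w♯(x) = −Im w(x)` and both are `≤ 0`). [cite: MoeglinWaldspurger1995, IV.1.10–IV.1.11, IV.2.3, IV.3.12 (a)]
[cite: Langlands1976, §7] -/
theorem im_apply_eq_zero_of_normSq_eq_chiFourTerm {x : ℝ} (hx : 1 < x) {Cμ CK : ℝ} (hC : 0 < Cμ * CK) (a : ℝ) {T : ℝ} (hT : 0 < T)
    {w : ℂ → ℂ} (hw : ContinuousAt w (x : ℂ)) {B : ℂ → ℂ → ℂ} {B₀ : ℝ} (hB₁ : ∀ᶠ z in 𝓝[≠] (x : ℂ), 0 < z.im → ‖B z z‖ ≤ B₀)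
    (hB₂ : ∀ᶠ u in 𝓝[≠] (x : ℂ), 0 < u.im → ‖B (conj u) (conj u)‖ ≤ B₀)
    (N₁ N₂ : ℂ → ℝ) (hN₁ : ∀ z, 0 ≤ N₁ z) (hN₂ : ∀ z, 0 ≤ N₂ z)
    (hMS₁ : ∀ᶠ z in 𝓝[≠] (x : ℂ), 0 < z.im → ((N₁ z : ℝ) : ℂ) = ((Cμ : ℝ) : ℂ) * (((CK : ℝ) : ℂ) *
        ((((T : ℝ) : ℂ) ^ (z + conj z - 2) / (z + conj z - 2)) * ((a : ℝ) : ℂ)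
          + (((T : ℝ) : ℂ) ^ (z - conj z) / (z - conj z)) * conj (w z)
          - (((T : ℝ) : ℂ) ^ (-(z - conj z)) / (z - conj z)) * w z
          - (((T : ℝ) : ℂ) ^ (-(z + conj z - 2)) / (z + conj z - 2)) * B z z)))
    (hMS₂ : ∀ᶠ u in 𝓝[≠] (x : ℂ), 0 < u.im → ((N₂ u : ℝ) : ℂ) = ((Cμ : ℝ) : ℂ) * (((CK : ℝ) : ℂ) *
        ((((T : ℝ) : ℂ) ^ (u + conj u - 2) / (u + conj u - 2)) * ((a : ℝ) : ℂ)
          + (((T : ℝ) : ℂ) ^ (u - conj u) / (u - conj u)) * conj (conj (w (conj u)))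
          - (((T : ℝ) : ℂ) ^ (-(u - conj u)) / (u - conj u)) * conj (w (conj u))
          - (((T : ℝ) : ℂ) ^ (-(u + conj u - 2)) / (u + conj u - 2)) * conj (B (conj u) (conj u))))) :
    (w x).im = 0 := by
  have h₁ : (w x).im ≤ 0 := im_apply_le_zero_of_normSq_eq_chiFourTerm_upper hx hC a hT hw hB₁ N₁ hN₁ hMS₁
  have hw' : ContinuousAt (fun z : ℂ => conj (w (conj z))) (x : ℂ) := by
    have h1 : ContinuousAt w (conj (x : ℂ)) := by rw [conj_ofReal]; exact hw
    exact continuous_conj.continuousAt.comp (h1.comp continuous_conj.continuousAt)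
  have hB' : ∀ᶠ u in 𝓝[≠] (x : ℂ), 0 < u.im → ‖(fun z z' : ℂ => conj (B (conj z) (conj z'))) u u‖ ≤ B₀ := by
    filter_upwards [hB₂] with u hu hui
    rw [RCLike.norm_conj]
    exact hu hui
  have h₂ : ((fun z : ℂ => conj (w (conj z))) x).im ≤ 0 :=
    im_apply_le_zero_of_normSq_eq_chiFourTerm_upper (w := fun z : ℂ => conj (w (conj z))) (B := fun z z' : ℂ => conj (B (conj z) (conj z')))
      hx hC a hT hw' hB' N₂ hN₂ (by simpa only using hMS₂)
  have h₃ : ((fun z : ℂ => conj (w (conj z))) x).im = -(w x).im := by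
    simp only [conj_ofReal, conj_im]
  linarith

/-! ## §2 EXPORTS LEVEL: the closed-formula cross scalar `wc` is real at every real `x > 1` off the candidate pole set -/

section Exports
variable (L : Type) [Field L] [NumberField L] [IsCMField L] [MeasurableSpace (quasiSplit (↥(maximalRealSubfield L)) L (IsCMField.complexConj L) 3).Adelic] [BorelSpace (quasiSplit (↥(maximalRealSubfield L)) L (IsCMField.complexConj L) 3).Adelic]
  [MeasurableSpace (AdeleRing (𝓞 L) L)ˣ] [BorelSpace (AdeleRing (𝓞 L) L)ˣ]

/-- **AXIS REALITY OF `wc` OFF THE POLES, AT THE EXPORTS' LEVEL — NO LETTER.**  Binders of ★ p864494 `hMSP_of_exports_free_at` up to `hBagree` (the χ-pair section `φ` with the normalised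
structural data, the exports' continuation `Ec` with tube identity, closed co-discrete candidate set `P`, the (E6) family `Fam` at level `T ≥ 1`, the continued scalars `wc`, `Bc`
holomorphic off `P` with their tube agreements); then a real `x > 1` OFF `P` with `Bc z z` bounded near `x`: **`Im wc(x) = 0`**.  Proof: the tube identity with uniform constants
`Cμ, CK > 0` (★ `chiTube_threeScalars_uniform_free`) rewritten through the agreements, the two continued diagonal identities on the quarter-plane domains near `x` (★ p862892 §3 ∕ §4 over
★ `quarterDomains_of_codiscrete`, ★ `eventually_mem_quarterDomains_of_codiscrete`), and §1. [cite: MoeglinWaldspurger1995, IV.1.10–IV.1.11, IV.2.3, IV.3.12 (a)] [cite: Langlands1976, §7]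
[cite: BernsteinLapid2019, Thm 2.3, §4] -/
theorem im_wc_eq_zero_of_exports_free
    (μ : Measure (quasiSplit (↥(maximalRealSubfield L)) L (IsCMField.complexConj L) 3).automorphicQuotient) [(quasiSplit (↥(maximalRealSubfield L)) L (IsCMField.complexConj L) 3).IsAutomorphicMeasure μ]
    (νG : Measure (quasiSplit (↥(maximalRealSubfield L)) L (IsCMField.complexConj L) 3).Adelic) [νG.IsHaarMeasure] [νG.IsInvInvariant]
    (μK : Measure ((standardMaximalCompactGL 3 L).comap (adelicVal (↥(maximalRealSubfield L)) L (IsCMField.complexConj L) 3 ((StdForm.antidiagonal 3).over L)) : Subgroup (quasiSplit (↥(maximalRealSubfield L)) L (IsCMField.complexConj L) 3).Adelic))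
    [μK.IsHaarMeasure]
    (νI : Measure (AdeleRing (𝓞 L) L)ˣ) [νI.IsHaarMeasure]
    {𝓕I : Set (AdeleRing (𝓞 L) L)ˣ} (h𝓕I : IsIdeleClassDomain L 𝓕I)
    (ν : Measure ↥(adelicUnipotent (↥(maximalRealSubfield L)) L (IsCMField.complexConj L) 3)) [ν.IsHaarMeasure] [ν.IsInvInvariant]
    {𝓕 : Set ↥(adelicUnipotent (↥(maximalRealSubfield L)) L (IsCMField.complexConj L) 3)} (h𝓕N : IsFundamentalDomain ↥(rationalUnipotent (↥(maximalRealSubfield L)) L (IsCMField.complexConj L) 3) 𝓕 ν) (h𝓕1 : ν 𝓕 = 1)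
    (h𝓕c : IsCompact (closure 𝓕))
    {β : (quasiSplit (↥(maximalRealSubfield L)) L (IsCMField.complexConj L) 3).Adelic → ℝ≥0∞} (hβ : IsCoveringWeight ((arithmeticBorel (↥(maximalRealSubfield L)) L (IsCMField.complexConj L) 3).map (quasiSplit (↥(maximalRealSubfield L)) L (IsCMField.complexConj L) 3).arithmeticSubgroup.subtype) β)
    {T : ℝ≥0} (hT : 1 ≤ T)
    {χ₁ : HeckeCharacter L} {χ₂ : ↥(TorusDict.torus (IsCMField.complexConj L)) →ₜ* ℂˣ}
    (hχ₁ : χ₁.IsUnitary) (hρ₁ : ∀ r : ℝ≥0ˣ, χ₁ (posRealIdele L r) = 1) (hχ₂u : ∀ u, ‖((χ₂ u : ℂˣ) : ℂ)‖ = 1) (hχ₂ : TorusDict.IsAutomorphic (IsCMField.complexConj L) χ₂)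
    {φ : (quasiSplit (↥(maximalRealSubfield L)) L (IsCMField.complexConj L) 3).Adelic → ℂ} (hφc : Continuous φ) (hφ : IsChiSectionPair χ₁ χ₂ φ) {Cφ : ℝ} (hφC : ∀ x, ‖φ x‖ ≤ Cφ)
    -- the exports: tube identity, candidate pole set, the (E6) family at level `T`
    (Ec : ℂ → (quasiSplit (↥(maximalRealSubfield L)) L (IsCMField.complexConj L) 3).Adelic → ℂ) (hE2 : ∀ z : ℂ, 2 < z.re → Ec z = eisensteinSeriesU (flatSectionU φ z))
    {P : Set ℂ} (hPc : IsClosed P) (hPcd : ∀ z₀ : ℂ, ∀ᶠ s in 𝓝[≠] z₀, s ∉ P)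
    (Fam : ℂ → Lp ℂ 2 μ) (hFd : DifferentiableOn ℂ Fam Pᶜ)
    (hFam : ∀ z : ℂ, z ∉ P → ((Fam z : Lp ℂ 2 μ) : (quasiSplit (↥(maximalRealSubfield L)) L (IsCMField.complexConj L) 3).automorphicQuotient → ℂ) =ᵐ[μ] (quasiSplit (↥(maximalRealSubfield L)) L (IsCMField.complexConj L) 3).quotFun (truncation ν 𝓕 T (Ec z)))
    -- (L2) the continued scalars, holomorphic off `P`, with their tube agreements
    {wc : ℂ → ℂ} (hwc : DifferentiableOn ℂ wc Pᶜ)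
    (hwagree : ∀ s : ℂ, 2 < s.re → wc s = ∫ x in {x : (AdeleRing (𝓞 L) L)ˣ | (IdeleClassGroup.ideleNorm L x : ℝ) ≤ 1} ∩ 𝓕I, ((IdeleClassGroup.ideleNorm L x : ℝ) : ℂ) * (((reflectChar (IsCMField.complexConj L) χ₁ x : ℂˣ) : ℂ) * conj ((χ₁ x : ℂˣ) : ℂ) * (∫ k, (fun g : (quasiSplit (↥(maximalRealSubfield L)) L (IsCMField.complexConj L) 3).Adelic => (∫ v : ↥(adelicUnipotent (↥(maximalRealSubfield L)) L (IsCMField.complexConj L) 3), flatSectionU φ s ((quasiSplit (↥(maximalRealSubfield L)) L (IsCMField.complexConj L) 3).toAdelic (weylLongU ((IsCMField.complexConj L : L ≃ₐ[↥(maximalRealSubfield L)] L) : L →+* L) (rfl : (StdForm.antidiagonal 3).over L = (StdForm.antidiagonal 3).over L)) * ((v : (quasiSplit (↥(maximalRealSubfield L)) L (IsCMField.complexConj L) 3).Adelic) * g)) ∂ν) * ((borelHeight g : ℝ) : ℂ) ^ (s - 2)) (k : (quasiSplit (↥(maximalRealSubfield L)) L (IsCMField.complexConj L) 3).Adelic)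 * conj (φ (k : (quasiSplit (↥(maximalRealSubfield L)) L (IsCMField.complexConj L) 3).Adelic)) ∂μK)) ∂νI)
    {Bc : ℂ → ℂ → ℂ} (hBc1 : ∀ z' : ℂ, DifferentiableOn ℂ (fun z : ℂ => Bc z z') Pᶜ) (hBc2 : ∀ z : ℂ, DifferentiableOn ℂ (fun u : ℂ => Bc z (conj u)) {u : ℂ | conj u ∉ P})
    (hBagree : ∀ s s' : ℂ, 2 < s.re → 2 < s'.re → Bc s s' = (∫ x in {x : (AdeleRing (𝓞 L) L)ˣ | (IdeleClassGroup.ideleNorm L x : ℝ) ≤ 1} ∩ 𝓕I, ((IdeleClassGroup.ideleNorm L x : ℝ) : ℂ) ∂νI) * (∫ k, (fun g : (quasiSplit (↥(maximalRealSubfield L)) L (IsCMField.complexConj L) 3).Adelic => (∫ v : ↥(adelicUnipotent (↥(maximalRealSubfield L)) L (IsCMField.complexConj L) 3), flatSectionU φ s ((quasiSplit (↥(maximalRealSubfield L)) L (IsCMField.complexConj L) 3).toAdelic (weylLongU ((IsCMField.complexConj L : L ≃ₐ[↥(maximalRealSubfield L)] L) : L →+* L) (rfl : (StdForm.antidiagonal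 3).over L = (StdForm.antidiagonal 3).over L)) * ((v : (quasiSplit (↥(maximalRealSubfield L)) L (IsCMField.complexConj L) 3).Adelic) * g)) ∂ν) * ((borelHeight g : ℝ) : ℂ) ^ (s - 2)) (k : (quasiSplit (↥(maximalRealSubfield L)) L (IsCMField.complexConj L) 3).Adelic) * conj ((fun g : (quasiSplit (↥(maximalRealSubfield L)) L (IsCMField.complexConj L) 3).Adelic => (∫ v : ↥(adelicUnipotent (↥(maximalRealSubfield L)) L (IsCMField.complexConj L) 3), flatSectionU φ s' ((quasiSplit (↥(maximalRealSubfield L)) L (IsCMField.complexConj L) 3).toAdelic (weylLongU ((IsCMField.complexConj L : L ≃ₐ[↥(maximalRealSubfield L)] L) : L →+* L) (rfl : (StdForm.antidiagonal 3).over L = (StdForm.antidiagonal 3).over L)) * ((v : (quasiSplit (↥(maximalRealSubfield L)) L (IsCMField.complexConj L) 3).Adelic) * g)) ∂ν) * ((borelHeight g : ℝ) : ℂ) ^ (s' - 2)) (k : (quasiSplit (↥(maximalRealSubfield L)) L (IsCMField.complexConj L) 3).Adelic)) ∂μK))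
    -- a REGULAR real point off the candidate set, with the diagonal kernel bounded near it
    {x : ℝ} (hx : 1 < x) (hxP : ((x : ℝ) : ℂ) ∉ P) (hβB : ∃ B : ℝ, ∀ᶠ z in 𝓝[≠] ((x : ℝ) : ℂ), ‖Bc z z‖ ≤ B) :
    (wc (x : ℂ)).im = 0 := by
  have hT0 : (0 : ℝ) < (T : ℝ) := by exact_mod_cast (zero_lt_one.trans_le hT)
  have hz₀ : 1 < ((x : ℝ) : ℂ).re := by rwa [ofReal_re]
  obtain ⟨⟨hD₁, hD₁c, hD₁sub, ⟨O₁, O₂', hO₁, hO₁ne, hO₁D, hO₂', hO₂'ne, hO₂'D, hsep⟩, -⟩, ⟨hD₂, hD₂c, hD₂sub, ⟨Q₁, Q₂', hQ₁, hQ₁ne, hQ₁D, hQ₂', hQ₂'ne, hQ₂'D, hsep₂⟩, -⟩⟩ :=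
    quarterDomains_of_codiscrete hPc hPcd one_lt_two
  obtain ⟨hD₁ev, hD₂ev⟩ := eventually_mem_quarterDomains_of_codiscrete hPcd hz₀
  have hFtube : ∀ D : Set ℂ, D ⊆ Pᶜ → ∀ z ∈ D, 2 < z.re → ((Fam z : Lp ℂ 2 μ) : (quasiSplit (↥(maximalRealSubfield L)) L (IsCMField.complexConj L) 3).automorphicQuotient → ℂ) =ᵐ[μ]
      (quasiSplit (↥(maximalRealSubfield L)) L (IsCMField.complexConj L) 3).quotFun (truncation ν 𝓕 T (eisensteinSeriesU (flatSectionU φ z))) := fun D hD z hz hz2 => by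
    rw [← hE2 z hz2]; exact hFam z (hD hz)
  have hD₁P : ((({z : ℂ | 1 < z.re} ∩ {z : ℂ | 0 < z.im}) ∩ univ) \ P) ⊆ Pᶜ := fun z hz => hz.2
  have hD₂P : ((({z : ℂ | 1 < z.re} ∩ {z : ℂ | z.im < 0}) ∩ univ) \ P) ⊆ Pᶜ := fun z hz => hz.2
  -- the tube identity with the scalars of record and UNIFORM constants `Cμ, CK > 0`, rewritten through the tube agreements
  obtain ⟨Cμ, CK, hCμ, hCK, hU⟩ := chiTube_threeScalars_uniform_free L μ νG μK νI h𝓕I ν h𝓕N h𝓕1 h𝓕c hβ hT hχ₁ hρ₁ hχ₂u hχ₂ hφc hφ hφC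
  have hMStube : ∀ {D : Set ℂ}, (∀ z ∈ D, 2 < z.re → ((Fam z : Lp ℂ 2 μ) : (quasiSplit (↥(maximalRealSubfield L)) L (IsCMField.complexConj L) 3).automorphicQuotient → ℂ) =ᵐ[μ] (quasiSplit (↥(maximalRealSubfield L)) L (IsCMField.complexConj L) 3).quotFun (truncation ν 𝓕 T (eisensteinSeriesU (flatSectionU φ z)))) →
      ∀ z ∈ D, ∀ z' ∈ D, 2 < z'.re → z'.re < z.re →
      ⟪Fam z', Fam z⟫_ℂ = ((Cμ : ℝ) : ℂ) * (((CK : ℝ) : ℂ) *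
        ((((T : ℝ) : ℂ) ^ (z + conj z' - 2) / (z + conj z' - 2)) * ((((∫ x in {x : (AdeleRing (𝓞 L) L)ˣ | (IdeleClassGroup.ideleNorm L x : ℝ) ≤ 1} ∩ 𝓕I, (IdeleClassGroup.ideleNorm L x : ℝ) ∂νI) * (∫ k, ‖φ (k : (quasiSplit (↥(maximalRealSubfield L)) L (IsCMField.complexConj L) 3).Adelic)‖ ^ 2 ∂μK)) : ℝ) : ℂ)
          + (((T : ℝ) : ℂ) ^ (z - conj z') / (z - conj z')) * conj (wc z')
          - (((T : ℝ) : ℂ) ^ (-(z - conj z')) / (z - conj z')) * wc z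
          - (((T : ℝ) : ℂ) ^ (-(z + conj z' - 2)) / (z + conj z' - 2)) * Bc z z')) := by
    intro D hFt z hz z' hz' h1 h2
    rw [hU Fam hFt z hz z' hz' h1 h2, hwagree z (h1.trans h2), hwagree z' h1, hBagree z z' (h1.trans h2) h1]
  have hconj : Tendsto (fun z : ℂ => conj z) (𝓝[≠] ((x : ℝ) : ℂ)) (𝓝[≠] ((x : ℝ) : ℂ)) := by
    refine tendsto_nhdsWithin_iff.2 ⟨?_, ?_⟩
    · simpa only [conj_ofReal] using ((continuous_conj : Continuous fun z : ℂ => conj z).tendsto ((x : ℝ) : ℂ)).mono_left nhdsWithin_le_nhds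
    · filter_upwards [self_mem_nhdsWithin] with z hz
      rw [mem_compl_singleton_iff] at hz ⊢
      exact fun h => hz (by rw [← conj_conj z, h, conj_ofReal])
  obtain ⟨B₀, hB₀⟩ := hβB
  have hwx : ContinuousAt wc ((x : ℝ) : ℂ) := (hwc.differentiableAt (hPc.isOpen_compl.mem_nhds hxP)).continuousAt
  exact im_apply_eq_zero_of_normSq_eq_chiFourTerm hx (mul_pos hCμ hCK) ((∫ x in {x : (AdeleRing (𝓞 L) L)ˣ | (IdeleClassGroup.ideleNorm L x : ℝ) ≤ 1} ∩ 𝓕I, (IdeleClassGroup.ideleNorm L x : ℝ) ∂νI) * (∫ k, ‖φ (k : (quasiSplit (↥(maximalRealSubfield L)) L (IsCMField.complexConj L) 3).Adelic)‖ ^ 2 ∂μK)) hT0 hwx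
    (hB₀.mono fun z hz _ => hz) ((hconj.eventually hB₀).mono fun u hu _ => hu) (fun z => ‖Fam z‖ ^ 2) (fun u => ‖Fam (conj u)‖ ^ 2) (fun _ => sq_nonneg _) (fun _ => sq_nonneg _)
    (hD₁ev.mono fun z hz hzim => normSq_family_eq_chiFourTerm_of_tube hD₁ hD₁c hD₁sub hO₁ hO₁ne hO₁D hO₂' hO₂'ne hO₂'D hsep Cμ CK _ hT0 (hwc.mono hD₁P)
      (fun z' _ => (hBc1 z').mono hD₁P) (fun z _ => (hBc2 z).mono fun u hu => hu.2) Fam (hFd.mono hD₁P) (hMStube (hFtube _ hD₁P)) (hz hzim))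
    ((hconj.eventually hD₂ev).mono fun u hu huim => normSq_family_eq_chiFourTerm_lower_of_tube hD₂ hD₂c hD₂sub hQ₁ hQ₁ne hQ₁D hQ₂' hQ₂'ne hQ₂'D hsep₂ Cμ CK _ hT0 (hwc.mono hD₂P)
      (fun z' _ => (hBc1 z').mono hD₂P) (fun z _ => (hBc2 z).mono fun u hu => hu.2) Fam (hFd.mono hD₂P) (hMStube (hFtube _ hD₂P)) (hu (by rw [conj_im]; linarith)))

end Exports

/-! ## §3 OF RECORD: the `hreal` letter of ★ p864687 at the NAMED witness family, letter-free; `hMSP′` of ONE letter -/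

section OfRecord
variable (L : Type) [Field L] [NumberField L] [IsCMField L] [MeasurableSpace (quasiSplit (↥(maximalRealSubfield L)) L (IsCMField.complexConj L) 3).Adelic] [BorelSpace (quasiSplit (↥(maximalRealSubfield L)) L (IsCMField.complexConj L) 3).Adelic]
  [MeasurableSpace (arch (↥(maximalRealSubfield L)) L (IsCMField.complexConj L) 3 ((StdForm.antidiagonal 3).over L))] [BorelSpace (arch (↥(maximalRealSubfield L)) L (IsCMField.complexConj L) 3 ((StdForm.antidiagonal 3).over L))]
  [MeasurableSpace (finAdelic (↥(maximalRealSubfield L)) L (IsCMField.complexConj L) 3 ((StdForm.antidiagonal 3).over L))] [BorelSpace (finAdelic (↥(maximalRealSubfield L)) L (IsCMField.complexConj L) 3 ((StdForm.antidiagonal 3).over L))]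
  [MeasurableSpace (AdeleRing (𝓞 L) L)ˣ] [BorelSpace (AdeleRing (𝓞 L) L)ˣ]

/-- **HEAD — THE NAMED GLOBAL LETTER `hreal` OF ★ p864687 `hMSP'_midWitness_of_coordLetters`, BYTE FOR BYTE, LETTER-FREE**: at the NAMED witness family (★ `midWitnessExports_spec`'s binders
VERBATIM) with the Maass–Selberg frame extras (`μK`, `νI`, an idele-class domain `𝓕I`, `ν 𝓕 = 1`, `χ` unitary and trivial on the positive reals), for every real `x > 1` with
`↑x ∉ midWitnessP`:  `Im( (Σ_j midWitnessQc j x · ∫_K bV_j·conj φ dμK) · ∫_{‖·‖≤1 ∩ 𝓕I} ‖·‖·χʷ·conj χ dνI ) = 0`.  Proof: (E6) ★ `hE6_midWitness` at level `T = 1`, (L2) of record ★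
`exists_scalars_of_coords_global`, the coordinates ANALYTIC AT `x ∉ midWitnessP` by the spec's clause 13 (so `Bc z z` is bounded near `x`, ★ `exists_eventually_norm_kernelDiag_le_of_coords`),
§2, and the closed formula of `wc`.  NO adjoint relation, NO self-associate hypothesis, NO `hqa`. [cite: MoeglinWaldspurger1995, IV.1.10–IV.1.11, IV.2.3, IV.3.12 (a)] [cite: Langlands1976, §7]
[cite: BernsteinLapid2019, Thm 2.3, §4] -/
theorem hreal_midWitness
    (μ : Measure (quasiSplit (↥(maximalRealSubfield L)) L (IsCMField.complexConj L) 3).automorphicQuotient) [(quasiSplit (↥(maximalRealSubfield L)) L (IsCMField.complexConj L) 3).IsAutomorphicMeasure μ]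
    (νG : Measure (quasiSplit (↥(maximalRealSubfield L)) L (IsCMField.complexConj L) 3).Adelic) [νG.IsHaarMeasure] [νG.IsInvInvariant] [SFinite νG]
    (ν : Measure ↥(adelicUnipotent (↥(maximalRealSubfield L)) L (IsCMField.complexConj L) 3)) [ν.IsHaarMeasure] [ν.IsMulRightInvariant] [ν.IsInvInvariant]
    {𝓕 : Set ↥(adelicUnipotent (↥(maximalRealSubfield L)) L (IsCMField.complexConj L) 3)}
    (h𝓕N : IsFundamentalDomain ↥(rationalUnipotent (↥(maximalRealSubfield L)) L (IsCMField.complexConj L) 3) 𝓕 ν) (h𝓕c : IsCompact (closure 𝓕)) (h𝓕₀ : ν 𝓕 ≠ 0)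
    {β : (quasiSplit (↥(maximalRealSubfield L)) L (IsCMField.complexConj L) 3).Adelic → ℝ≥0∞}
    (hβ : IsCoveringWeight ↥((arithmeticBorel (↥(maximalRealSubfield L)) L (IsCMField.complexConj L) 3).map (quasiSplit (↥(maximalRealSubfield L)) L (IsCMField.complexConj L) 3).arithmeticSubgroup.subtype) β)
    {μZ : Measure (borelQuotient (↥(maximalRealSubfield L)) L (IsCMField.complexConj L) 3)} [SFinite μZ]
    (hμZ : ∀ f : borelQuotient (↥(maximalRealSubfield L)) L (IsCMField.complexConj L) 3 → ℝ≥0∞, Measurable f → ∫⁻ z, f z ∂μZ = ∫⁻ g, β g * f (toBorelQuotient (↥(maximalRealSubfield L)) L (IsCMField.complexConj L) 3 g) ∂νG)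
    -- the M1 family: `φ ∈ V(χ, K, 1)` continuous bounded with `φ ∘ ι_∞ = φ(1)`, and a basis of `V(χʷ, K, 1)` by continuous bounded functions
    {χ : HeckeCharacter L} {K' : Subgroup (quasiSplit (↥(maximalRealSubfield L)) L (IsCMField.complexConj L) 3).Adelic} {ω : ↥K' → ℂ} {φ : (quasiSplit (↥(maximalRealSubfield L)) L (IsCMField.complexConj L) 3).Adelic → ℂ} (hφV : φ ∈ chiSectionSpace χ K' ω) (hφc : Continuous φ) {Mφ : ℝ} (hφM : ∀ x, ‖φ x‖ ≤ Mφ)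
    -- the LEVEL: `K′ ≤ K`, `ι(K_∞) ⊆ K′`, an open compact `U₀` with `ι_f(U₀ ∩ G_f) ⊆ K′` on which `ω = 1`, continuity of the sections; auxiliary Haar measures on `G_∞` (two-sided) and `G(𝔸_f)`
    (hK' : K' ≤ ((standardMaximalCompactGL 3 L).comap (adelicVal (↥(maximalRealSubfield L)) L (IsCMField.complexConj L) 3 ((StdForm.antidiagonal 3).over L)) : Subgroup (quasiSplit (↥(maximalRealSubfield L)) L (IsCMField.complexConj L) 3).Adelic))
    (hKinf : ∀ k : arch (↥(maximalRealSubfield L)) L (IsCMField.complexConj L) 3 ((StdForm.antidiagonal 3).over L), adelicVal (↥(maximalRealSubfield L)) L (IsCMField.complexConj L) 3 ((StdForm.antidiagonal 3).over L) (archToAdelic (↥(maximalRealSubfield L)) L (IsCMField.complexConj L) 3 _ k) ∈ standardMaximalCompactGL 3 L →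
      archToAdelic (↥(maximalRealSubfield L)) L (IsCMField.complexConj L) 3 _ k ∈ K')
    (U₀ : Subgroup (GL (Fin 3) (FiniteAdeleRing (𝓞 L) L))) (hU₀o : IsOpen (U₀ : Set (GL (Fin 3) (FiniteAdeleRing (𝓞 L) L)))) (hU₀c : IsCompact (U₀ : Set (GL (Fin 3) (FiniteAdeleRing (𝓞 L) L))))
    (hU : ∀ b : finAdelic (↥(maximalRealSubfield L)) L (IsCMField.complexConj L) 3 ((StdForm.antidiagonal 3).over L), (b : GL (Fin 3) (FiniteAdeleRing (𝓞 L) L)) ∈ U₀ →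
      ∃ hb : finAdelicToAdelic (↥(maximalRealSubfield L)) L (IsCMField.complexConj L) 3 ((StdForm.antidiagonal 3).over L) b ∈ K', ω ⟨_, hb⟩ = 1)
    (hVc : ∀ φ ∈ chiSectionSpace χ K' ω, Continuous φ)
    (μa : Measure (arch (↥(maximalRealSubfield L)) L (IsCMField.complexConj L) 3 ((StdForm.antidiagonal 3).over L))) [μa.IsHaarMeasure] [μa.IsMulRightInvariant]
    (μf : Measure (finAdelic (↥(maximalRealSubfield L)) L (IsCMField.complexConj L) 3 ((StdForm.antidiagonal 3).over L))) [μf.IsHaarMeasure]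
    {ι' : Type} [Fintype ι'] [DecidableEq ι'] (bV : Module.Basis ι' ℂ ↥(chiSectionSpace (reflectChar (IsCMField.complexConj L) χ) K' ω))
    (hbc : ∀ j, Continuous ((bV j : ↥(chiSectionSpace (reflectChar (IsCMField.complexConj L) χ) K' ω)) : (quasiSplit (↥(maximalRealSubfield L)) L (IsCMField.complexConj L) 3).Adelic → ℂ)) {Mb : ℝ} (hbM : ∀ j x, ‖((bV j : ↥(chiSectionSpace (reflectChar (IsCMField.complexConj L) χ) K' ω)) : (quasiSplit (↥(maximalRealSubfield L)) L (IsCMField.complexConj L) 3).Adelic → ℂ) x‖ ≤ Mb)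
    (h2 : Module.finrank (↥(maximalRealSubfield L)) L = 2) (hc : IsCMField.complexConj L ≠ 1) (hJ : ((StdForm.antidiagonal 3).over L).det ≠ 0)
    (ψ : ↥(TorusDict.torus (IsCMField.complexConj L)) →ₜ* ℂˣ) (hψ : TorusDict.IsAutomorphic (IsCMField.complexConj L) ψ)
    -- the Maass–Selberg frame extras
    (μK : Measure ((standardMaximalCompactGL 3 L).comap (adelicVal (↥(maximalRealSubfield L)) L (IsCMField.complexConj L) 3 ((StdForm.antidiagonal 3).over L)) : Subgroup (quasiSplit (↥(maximalRealSubfield L)) L (IsCMField.complexConj L) 3).Adelic))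
    [μK.IsHaarMeasure]
    (νI : Measure (AdeleRing (𝓞 L) L)ˣ) [νI.IsHaarMeasure]
    {𝓕I : Set (AdeleRing (𝓞 L) L)ˣ} (h𝓕I : IsIdeleClassDomain L 𝓕I) (h𝓕1 : ν 𝓕 = 1)
    (hχ₁ : χ.IsUnitary) (hρ₁ : ∀ r : ℝ≥0ˣ, χ (posRealIdele L r) = 1) :
    ∀ x : ℝ, 1 < x → ((x : ℝ) : ℂ) ∉ midWitnessP L μ νG ν h𝓕N h𝓕c h𝓕₀ hβ hμZ hφV hφc hφM hK' hKinf U₀ hU₀o hU₀c hU hVc μa μf bV hbc hbM h2 hc hJ ψ hψ →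
      (((∑ j, midWitnessQc L μ νG ν h𝓕N h𝓕c h𝓕₀ hβ hμZ hφV hφc hφM hK' hKinf U₀ hU₀o hU₀c hU hVc μa μf bV hbc hbM h2 hc hJ ψ hψ j (x : ℂ) * ∫ k, ((bV j : ↥(chiSectionSpace (reflectChar (IsCMField.complexConj L) χ) K' ω)) : (quasiSplit (↥(maximalRealSubfield L)) L (IsCMField.complexConj L) 3).Adelic → ℂ) (k : (quasiSplit (↥(maximalRealSubfield L)) L (IsCMField.complexConj L) 3).Adelic) * conj (φ (k : (quasiSplit (↥(maximalRealSubfield L)) L (IsCMField.complexConj L) 3).Adelic)) ∂μK) *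
        ∫ x in {x : (AdeleRing (𝓞 L) L)ˣ | (IdeleClassGroup.ideleNorm L x : ℝ) ≤ 1} ∩ 𝓕I, ((IdeleClassGroup.ideleNorm L x : ℝ) : ℂ) * (((reflectChar (IsCMField.complexConj L) χ x : ℂˣ) : ℂ) * conj ((χ x : ℂˣ) : ℂ)) ∂νI)).im = 0 := by
  intro x hx hxP
  -- the spec's clauses: 2 `hqφ`, 5 tube identity, 6 `qc = q` on the tube, 7 closed, 8 co-discrete, 13 `qc` holomorphic off `P`
  obtain ⟨-, hqφ, -, -, hE2, hqcq, hPc, hPcd, -, -, -, -, hqcP, -, -, -⟩ := midWitnessExports_spec L μ νG ν h𝓕N h𝓕c h𝓕₀ hβ hμZ hφV hφc hφM hK' hKinf U₀ hU₀o hU₀c hU hVc μa μf bV hbc hbM h2 hc hJ ψ hψ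
  -- the (E6) family at the named pair (★ p864608) at level `T = 1`
  obtain ⟨Fam, hFd, hFam⟩ := hE6_midWitness L μ νG ν h𝓕N h𝓕c h𝓕₀ hβ hμZ hφV hφc hφM hK' hKinf U₀ hU₀o hU₀c hU hVc μa μf bV hbc hbM h2 hc hJ ψ hψ (le_refl (1 : ℝ≥0))
  -- (L2) of record on the basis `bV` of `V(χʷ, K′, ω)`
  obtain ⟨wc, Bc, hwc, hwagree, hBc1, hBc2, hBagree, hwcf, hBcf⟩ := exists_scalars_of_coords_global L μK νI 𝓕I ν h𝓕1 χ φ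
    (fun j => ((bV j : ↥(chiSectionSpace (reflectChar (IsCMField.complexConj L) χ) K' ω)) : (quasiSplit (↥(maximalRealSubfield L)) L (IsCMField.complexConj L) 3).Adelic → ℂ))
    hqφ hqcP hqcq hPc (fun j => integrable_restrict_mul_conj_of_bounded L μK (hbc j) hφc (hbM j) hφM)
    (fun j l => integrable_restrict_mul_conj_of_bounded L μK (hbc j) (hbc l) (hbM j) (hbM l))
  have hφ : IsChiSectionPair χ (1 : ↥(TorusDict.torus (IsCMField.complexConj L)) →ₜ* ℂˣ) φ :=
    IsChiSection.isChiSectionPair_of_trivial (one_apply_torus (IsCMField.complexConj L)) (isChiSection_of_mem hφV)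
  have hχ₂u : ∀ u : ↥(TorusDict.torus (IsCMField.complexConj L)), ‖(((1 : ↥(TorusDict.torus (IsCMField.complexConj L)) →ₜ* ℂˣ) u : ℂˣ) : ℂ)‖ = 1 := fun u => by
    rw [one_apply_torus]; simp
  -- at `x ∉ P` every continued coordinate is analytic (clause 13), so the diagonal kernel is bounded near `x`
  have hqa₀ : ∀ j, AnalyticAt ℂ (midWitnessQc L μ νG ν h𝓕N h𝓕c h𝓕₀ hβ hμZ hφV hφc hφM hK' hKinf U₀ hU₀o hU₀c hU hVc μa μf bV hbc hbM h2 hc hJ ψ hψ j) ((x : ℝ) : ℂ) := fun j =>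
    (hqcP j).analyticAt (hPc.isOpen_compl.mem_nhds hxP)
  have hβB : ∃ B : ℝ, ∀ᶠ z in 𝓝[≠] ((x : ℝ) : ℂ), ‖Bc z z‖ ≤ B := exists_eventually_norm_kernelDiag_le_of_coords hqa₀ _ _ hBcf
  have key := im_wc_eq_zero_of_exports_free L μ νG μK νI h𝓕I ν h𝓕N h𝓕1 h𝓕c hβ (le_refl (1 : ℝ≥0)) hχ₁ hρ₁ hχ₂u (isAutomorphic_one (IsCMField.complexConj L)) hφc hφ hφM
    (midWitnessEc L μ νG ν h𝓕N h𝓕c h𝓕₀ hβ hμZ hφV hφc hφM hK' hKinf U₀ hU₀o hU₀c hU hVc μa μf bV hbc hbM h2 hc hJ ψ hψ) hE2 hPc hPcd Fam hFd hFam hwc hwagree hBc1 hBc2 hBagree hx hxP hβB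
  rw [hwcf] at key
  exact key

/-- **`hMSP′` AT THE NAMED WITNESS FAMILY OF ONE COORDINATE LETTER** — ★ p864687 `hMSP'_midWitness_of_coordLetters` with its axis-reality letter `hreal` DISCHARGED by `hreal_midWitness`:
only `hqa` («the continued coordinates are analytic at the candidates of `{1 < Re} ∖ {3∕2}`», the scalar half) remains. [cite: MoeglinWaldspurger1995, IV.1.10–IV.1.11, IV.3.12 (a)]
[cite: BernsteinLapid2019, §4 p. 10] [cite: Rogawski1990, §13.9 p. 229] -/
theorem hMSP'_midWitness_of_coordLetter
    (μ : Measure (quasiSplit (↥(maximalRealSubfield L)) L (IsCMField.complexConj L) 3).automorphicQuotient) [(quasiSplit (↥(maximalRealSubfield L)) L (IsCMField.complexConj L) 3).IsAutomorphicMeasure μ]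
    (νG : Measure (quasiSplit (↥(maximalRealSubfield L)) L (IsCMField.complexConj L) 3).Adelic) [νG.IsHaarMeasure] [νG.IsInvInvariant] [SFinite νG]
    (ν : Measure ↥(adelicUnipotent (↥(maximalRealSubfield L)) L (IsCMField.complexConj L) 3)) [ν.IsHaarMeasure] [ν.IsMulRightInvariant] [ν.IsInvInvariant]
    {𝓕 : Set ↥(adelicUnipotent (↥(maximalRealSubfield L)) L (IsCMField.complexConj L) 3)}
    (h𝓕N : IsFundamentalDomain ↥(rationalUnipotent (↥(maximalRealSubfield L)) L (IsCMField.complexConj L) 3) 𝓕 ν) (h𝓕c : IsCompact (closure 𝓕)) (h𝓕₀ : ν 𝓕 ≠ 0)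
    {β : (quasiSplit (↥(maximalRealSubfield L)) L (IsCMField.complexConj L) 3).Adelic → ℝ≥0∞}
    (hβ : IsCoveringWeight ↥((arithmeticBorel (↥(maximalRealSubfield L)) L (IsCMField.complexConj L) 3).map (quasiSplit (↥(maximalRealSubfield L)) L (IsCMField.complexConj L) 3).arithmeticSubgroup.subtype) β)
    {μZ : Measure (borelQuotient (↥(maximalRealSubfield L)) L (IsCMField.complexConj L) 3)} [SFinite μZ]
    (hμZ : ∀ f : borelQuotient (↥(maximalRealSubfield L)) L (IsCMField.complexConj L) 3 → ℝ≥0∞, Measurable f → ∫⁻ z, f z ∂μZ = ∫⁻ g, β g * f (toBorelQuotient (↥(maximalRealSubfield L)) L (IsCMField.complexConj L) 3 g) ∂νG)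
    -- the M1 family: `φ ∈ V(χ, K, 1)` continuous bounded with `φ ∘ ι_∞ = φ(1)`, and a basis of `V(χʷ, K, 1)` by continuous bounded functions
    {χ : HeckeCharacter L} {K' : Subgroup (quasiSplit (↥(maximalRealSubfield L)) L (IsCMField.complexConj L) 3).Adelic} {ω : ↥K' → ℂ} {φ : (quasiSplit (↥(maximalRealSubfield L)) L (IsCMField.complexConj L) 3).Adelic → ℂ} (hφV : φ ∈ chiSectionSpace χ K' ω) (hφc : Continuous φ) {Mφ : ℝ} (hφM : ∀ x, ‖φ x‖ ≤ Mφ)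
    -- the LEVEL: `K′ ≤ K`, `ι(K_∞) ⊆ K′`, an open compact `U₀` with `ι_f(U₀ ∩ G_f) ⊆ K′` on which `ω = 1`, continuity of the sections; auxiliary Haar measures on `G_∞` (two-sided) and `G(𝔸_f)`
    (hK' : K' ≤ ((standardMaximalCompactGL 3 L).comap (adelicVal (↥(maximalRealSubfield L)) L (IsCMField.complexConj L) 3 ((StdForm.antidiagonal 3).over L)) : Subgroup (quasiSplit (↥(maximalRealSubfield L)) L (IsCMField.complexConj L) 3).Adelic))
    (hKinf : ∀ k : arch (↥(maximalRealSubfield L)) L (IsCMField.complexConj L) 3 ((StdForm.antidiagonal 3).over L), adelicVal (↥(maximalRealSubfield L)) L (IsCMField.complexConj L) 3 ((StdForm.antidiagonal 3).over L) (archToAdelic (↥(maximalRealSubfield L)) L (IsCMField.complexConj L) 3 _ k) ∈ standardMaximalCompactGL 3 L →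
      archToAdelic (↥(maximalRealSubfield L)) L (IsCMField.complexConj L) 3 _ k ∈ K')
    (U₀ : Subgroup (GL (Fin 3) (FiniteAdeleRing (𝓞 L) L))) (hU₀o : IsOpen (U₀ : Set (GL (Fin 3) (FiniteAdeleRing (𝓞 L) L)))) (hU₀c : IsCompact (U₀ : Set (GL (Fin 3) (FiniteAdeleRing (𝓞 L) L))))
    (hU : ∀ b : finAdelic (↥(maximalRealSubfield L)) L (IsCMField.complexConj L) 3 ((StdForm.antidiagonal 3).over L), (b : GL (Fin 3) (FiniteAdeleRing (𝓞 L) L)) ∈ U₀ →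
      ∃ hb : finAdelicToAdelic (↥(maximalRealSubfield L)) L (IsCMField.complexConj L) 3 ((StdForm.antidiagonal 3).over L) b ∈ K', ω ⟨_, hb⟩ = 1)
    (hVc : ∀ φ ∈ chiSectionSpace χ K' ω, Continuous φ)
    (μa : Measure (arch (↥(maximalRealSubfield L)) L (IsCMField.complexConj L) 3 ((StdForm.antidiagonal 3).over L))) [μa.IsHaarMeasure] [μa.IsMulRightInvariant]
    (μf : Measure (finAdelic (↥(maximalRealSubfield L)) L (IsCMField.complexConj L) 3 ((StdForm.antidiagonal 3).over L))) [μf.IsHaarMeasure]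
    {ι' : Type} [Fintype ι'] [DecidableEq ι'] (bV : Module.Basis ι' ℂ ↥(chiSectionSpace (reflectChar (IsCMField.complexConj L) χ) K' ω))
    (hbc : ∀ j, Continuous ((bV j : ↥(chiSectionSpace (reflectChar (IsCMField.complexConj L) χ) K' ω)) : (quasiSplit (↥(maximalRealSubfield L)) L (IsCMField.complexConj L) 3).Adelic → ℂ)) {Mb : ℝ} (hbM : ∀ j x, ‖((bV j : ↥(chiSectionSpace (reflectChar (IsCMField.complexConj L) χ) K' ω)) : (quasiSplit (↥(maximalRealSubfield L)) L (IsCMField.complexConj L) 3).Adelic → ℂ) x‖ ≤ Mb)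
    (h2 : Module.finrank (↥(maximalRealSubfield L)) L = 2) (hc : IsCMField.complexConj L ≠ 1) (hJ : ((StdForm.antidiagonal 3).over L).det ≠ 0)
    (ψ : ↥(TorusDict.torus (IsCMField.complexConj L)) →ₜ* ℂˣ) (hψ : TorusDict.IsAutomorphic (IsCMField.complexConj L) ψ)
    -- the Maass–Selberg frame extras
    (μK : Measure ((standardMaximalCompactGL 3 L).comap (adelicVal (↥(maximalRealSubfield L)) L (IsCMField.complexConj L) 3 ((StdForm.antidiagonal 3).over L)) : Subgroup (quasiSplit (↥(maximalRealSubfield L)) L (IsCMField.complexConj L) 3).Adelic))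
    [μK.IsHaarMeasure]
    (νI : Measure (AdeleRing (𝓞 L) L)ˣ) [νI.IsHaarMeasure]
    {𝓕I : Set (AdeleRing (𝓞 L) L)ˣ} (h𝓕I : IsIdeleClassDomain L 𝓕I) (h𝓕1 : ν 𝓕 = 1)
    (hχ₁ : χ.IsUnitary) (hρ₁ : ∀ r : ℝ≥0ˣ, χ (posRealIdele L r) = 1)
    -- THE ONE NAMED GLOBAL LETTER LEFT: coordinate analyticity at the candidates off `3∕2` (the scalar half)
    (hqa : ∀ j (z₀ : ℂ), z₀ ∈ midWitnessP L μ νG ν h𝓕N h𝓕c h𝓕₀ hβ hμZ hφV hφc hφM hK' hKinf U₀ hU₀o hU₀c hU hVc μa μf bV hbc hbM h2 hc hJ ψ hψ → 1 < z₀.re → z₀ ≠ (3 : ℂ) / 2 →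
      AnalyticAt ℂ (midWitnessQc L μ νG ν h𝓕N h𝓕c h𝓕₀ hβ hμZ hφV hφc hφM hK' hKinf U₀ hU₀o hU₀c hU hVc μa μf bV hbc hbM h2 hc hJ ψ hψ j) z₀) :
    ∀ z₀ ∈ midWitnessP L μ νG ν h𝓕N h𝓕c h𝓕₀ hβ hμZ hφV hφc hφM hK' hKinf U₀ hU₀o hU₀c hU hVc μa μf bV hbc hbM h2 hc hJ ψ hψ, 1 < z₀.re → z₀ ≠ (3 : ℂ) / 2 → ∀ T : ℝ≥0, 1 ≤ T →
      ∃ Fam : ℂ → (quasiSplit (↥(maximalRealSubfield L)) L (IsCMField.complexConj L) 3).L2 μ,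
        (∀ z : ℂ, z ∉ midWitnessP L μ νG ν h𝓕N h𝓕c h𝓕₀ hβ hμZ hφV hφc hφM hK' hKinf U₀ hU₀o hU₀c hU hVc μa μf bV hbc hbM h2 hc hJ ψ hψ → ((Fam z : (quasiSplit (↥(maximalRealSubfield L)) L (IsCMField.complexConj L) 3).L2 μ) : (quasiSplit (↥(maximalRealSubfield L)) L (IsCMField.complexConj L) 3).automorphicQuotient → ℂ) =ᵐ[μ] (quasiSplit (↥(maximalRealSubfield L)) L (IsCMField.complexConj L) 3).quotFun (truncation ν 𝓕 T (midWitnessEc L μ νG ν h𝓕N h𝓕c h𝓕₀ hβ hμZ hφV hφc hφM hK' hKinf U₀ hU₀o hU₀c hU hVc μa μf bV hbc hbM h2 hc hJ ψ hψ z))) ∧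
        ∃ C : ℝ, ∀ᶠ z in 𝓝[≠] z₀, ‖Fam z‖ ≤ C :=
  hMSP'_midWitness_of_coordLetters L μ νG ν h𝓕N h𝓕c h𝓕₀ hβ hμZ hφV hφc hφM hK' hKinf U₀ hU₀o hU₀c hU hVc μa μf bV hbc hbM h2 hc hJ ψ hψ μK νI h𝓕I h𝓕1 hχ₁ hρ₁ hqa
    (hreal_midWitness L μ νG ν h𝓕N h𝓕c h𝓕₀ hβ hμZ hφV hφc hφM hK' hKinf U₀ hU₀o hU₀c hU hVc μa μf bV hbc hbM h2 hc hJ ψ hψ μK νI h𝓕I h𝓕1 hχ₁ hρ₁)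

end OfRecord

end Summit.HodgeConjecture.HodgeConjecture.Cruxes.H413.K2E1ChiAxisRealityOfRecordCMThree

end
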